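import Summits.ABC.ABC.Theses.IneffectiveSubspace

/-!
# `DepthCountedABC` (stmt-ABC-14938): the 5-free cell is infinite (consecutive 5-free integers)

Negative-side support lemmas for the crux `Summit.ABC.ABC.Theses.IneffectiveSubspace.DepthCountedABC`
(abc with `C = C(K, ε)` on each depth cell `ω₅(abc) ≤ K`), from the crux disprover's cycle-1 attack
(`Cruxes/DepthCountedABC/Disproof.lean`, section B).  The cell condition is an UPPER bound on the
number of 5-deep primes, so membership of an infinite family in a fixed cell has to be CERTIFIED;
this file supplies the one certified infinite family that elementary counting gives:

* `card_not_fiveFree_le` — at most `3X/64` integers in `[1, X]` are divisible by the fifth power of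
  a prime (`Σ_p ⌊X/p⁵⌋ ≤ X·Σ_{m ≥ 2} m⁻⁵ ≤ X·(1/32 + 1/64)` by the telescoping
  `m⁻⁵ ≤ ¼((m−1)⁻⁴ − m⁻⁴)`);
* `exists_consecutive_fiveFree` — for every `N` some `n > N` has `n` and `n + 1` both 5-free
  (window `(N, 2N + 64]`);
* `cellZero_unbounded` — hence the cell `K = 0` contains abc triples `(1, n, n + 1)` with `c`
  arbitrarily large: no cell is settled by a finite census and `C(0, ε)` is genuinely asymptotic;
* `depthCountedABC_false_without_eps_pos` — the sign condition `0 < ε` is load-bearing: quantified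
  over all real `ε` the crux fails at `ε = −1` (it would bound `c` on the 5-free cell).  The
  boundary `ε = 0` itself is the open question of `EpsZeroWieferich.lean`.
-/

set_option linter.dupNamespace false

namespace Summit.ABC.ABC.Theorems.DepthCountedABC.Negative

open Literature.NumberTheory.DiophantineGeometry UniqueFactorizationMonoid Finset

/-- Telescoping bound: `Σ_{3 ≤ m ≤ M} 1/m⁵ + 1/(4M⁴) ≤ 1/64` for `M ≥ 2`. [folklore] -/
theorem sum_Icc_three_inv_pow_five_le (M : ℕ) (hM : 2 ≤ M) :
    ∑ m ∈ Finset.Icc 3 M, (1 : ℝ) / (m : ℝ) ^ 5 + 1 / (4 * (M : ℝ) ^ 4) ≤ 1 / 64 := by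
  induction M, hM using Nat.le_induction with
  | base => norm_num
  | succ M hM ih =>
    rw [Finset.sum_Icc_succ_top (by omega : 3 ≤ M + 1)]
    have hMpos : (0 : ℝ) < M := by exact_mod_cast (by omega : 0 < M)
    have key : (1 : ℝ) / ((M + 1 : ℕ) : ℝ) ^ 5 + 1 / (4 * ((M + 1 : ℕ) : ℝ) ^ 4) ≤ 1 / (4 * (M : ℝ) ^ 4) := by
      push_cast
      rw [div_add_div _ _ (by positivity) (by positivity), div_le_div_iff₀ (by positivity) (by positivity)]
      nlinarith [pow_pos hMpos 2, pow_pos hMpos 3, pow_pos hMpos 4, pow_pos hMpos 5, pow_pos hMpos 6,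
        pow_pos hMpos 7, pow_pos hMpos 8]
    linarith

/-- `Σ_{2 ≤ m ≤ M} 1/m⁵ ≤ 3/64` (`1/32` plus the telescoped tail `≤ 1/64`). [folklore] -/
theorem sum_Icc_two_inv_pow_five_le (M : ℕ) :
    ∑ m ∈ Finset.Icc 2 M, (1 : ℝ) / (m : ℝ) ^ 5 ≤ 3 / 64 := by
  rcases lt_or_ge M 2 with hM | hM
  · rw [Finset.Icc_eq_empty (by omega)]; norm_num
  have hsplit : Finset.Icc 2 M = insert 2 (Finset.Icc 3 M) := by
    ext m; simp only [Finset.mem_Icc, Finset.mem_insert]; omega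
  rw [hsplit, Finset.sum_insert (by simp)]
  have htail := sum_Icc_three_inv_pow_five_le M hM
  have hpos : (0 : ℝ) ≤ 1 / (4 * (M : ℝ) ^ 4) := by positivity
  have h32 : (1 : ℝ) / ((2 : ℕ) : ℝ) ^ 5 = 1 / 32 := by norm_num
  rw [h32]
  linarith

open scoped Classical in
/-- **At most `3X/64` of the integers in `[1, X]` are divisible by a fifth power of a prime.**
[folklore] -/
theorem card_not_fiveFree_le (X : ℕ) :
    ((((Finset.Ioc 0 X).filter (fun n => ∃ p, p.Prime ∧ p ^ 5 ∣ n)).card : ℕ) : ℝ) ≤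
      3 * (X : ℝ) / 64 := by
  set P := (Finset.range (X + 1)).filter Nat.Prime with hP
  have hsub : (Finset.Ioc 0 X).filter (fun n => ∃ p, p.Prime ∧ p ^ 5 ∣ n) ⊆
      P.biUnion (fun p => (Finset.Ioc 0 X).filter (fun n => p ^ 5 ∣ n)) := by
    intro n hn
    simp only [Finset.mem_filter, Finset.mem_Ioc] at hn
    obtain ⟨⟨hn0, hnX⟩, p, hp, hpn⟩ := hn
    simp only [hP, Finset.mem_biUnion, Finset.mem_filter, Finset.mem_range, Finset.mem_Ioc]
    refine ⟨p, ⟨?_, hp⟩, ⟨hn0, hnX⟩, hpn⟩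
    have h1 : p ^ 5 ≤ n := Nat.le_of_dvd hn0 hpn
    have h2 : p ≤ p ^ 5 := Nat.le_self_pow (by norm_num) p
    omega
  have hPsub : P ⊆ Finset.Icc 2 X := by
    intro p hp
    simp only [hP, Finset.mem_filter, Finset.mem_range] at hp
    simp only [Finset.mem_Icc]
    exact ⟨hp.2.two_le, by omega⟩
  calc ((((Finset.Ioc 0 X).filter (fun n => ∃ p, p.Prime ∧ p ^ 5 ∣ n)).card : ℕ) : ℝ)
      ≤ ((P.biUnion (fun p => (Finset.Ioc 0 X).filter (fun n => p ^ 5 ∣ n))).card : ℝ) := by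
        exact_mod_cast Finset.card_le_card hsub
    _ ≤ ((∑ p ∈ P, ((Finset.Ioc 0 X).filter (fun n => p ^ 5 ∣ n)).card : ℕ) : ℝ) := by
        exact_mod_cast Finset.card_biUnion_le
    _ = ∑ p ∈ P, (((X / p ^ 5 : ℕ)) : ℝ) := by
        push_cast
        refine Finset.sum_congr rfl fun p _ => ?_
        rw [Nat.Ioc_filter_dvd_card_eq_div]
    _ ≤ ∑ p ∈ P, (X : ℝ) / (p : ℝ) ^ 5 := by
        refine Finset.sum_le_sum fun p _ => ?_
        have := Nat.cast_div_le (m := X) (n := p ^ 5) (α := ℝ)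
        push_cast at this
        exact this
    _ ≤ ∑ m ∈ Finset.Icc 2 X, (X : ℝ) / (m : ℝ) ^ 5 :=
        Finset.sum_le_sum_of_subset_of_nonneg hPsub (fun m _ _ => by positivity)
    _ = (X : ℝ) * ∑ m ∈ Finset.Icc 2 X, (1 : ℝ) / (m : ℝ) ^ 5 := by
        rw [Finset.mul_sum]
        refine Finset.sum_congr rfl fun m _ => ?_
        ring
    _ ≤ (X : ℝ) * (3 / 64) := by
        gcongr
        exact sum_Icc_two_inv_pow_five_le X
    _ = 3 * (X : ℝ) / 64 := by ring

/-- **Arbitrarily large consecutive 5-free integers.**  For every `N` there is `n > N` with both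
`n` and `n + 1` free of fifth powers of primes (counting: in the window `(N, 2N + 64]` at most
`3(2N+64)/64 + 3(2N+65)/64 < N + 64` integers `n` have `n` or `n + 1` divisible by some `p⁵`).
[folklore] -/
theorem exists_consecutive_fiveFree (N : ℕ) :
    ∃ n, N < n ∧ (∀ p, p.Prime → ¬ p ^ 5 ∣ n) ∧ (∀ p, p.Prime → ¬ p ^ 5 ∣ n + 1) := by
  classical
  by_contra hno
  push Not at hno
  set X := 2 * N + 64 with hX
  set W := Finset.Ioc N X with hW
  set B1 := W.filter (fun n => ∃ p, p.Prime ∧ p ^ 5 ∣ n) with hB1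
  set B2 := W.filter (fun n => ∃ p, p.Prime ∧ p ^ 5 ∣ n + 1) with hB2
  have hcover : W ⊆ B1 ∪ B2 := by
    intro n hn
    have hnN : N < n := (Finset.mem_Ioc.mp hn).1
    rw [Finset.mem_union, hB1, hB2, Finset.mem_filter, Finset.mem_filter]
    by_cases h1 : ∃ p, p.Prime ∧ p ^ 5 ∣ n
    · exact Or.inl ⟨hn, h1⟩
    · push Not at h1
      obtain ⟨p, hp, hpn⟩ := hno n hnN h1
      exact Or.inr ⟨hn, p, hp, hpn⟩
  have hB1le : ((B1.card : ℕ) : ℝ) ≤ 3 * (X : ℝ) / 64 := by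
    have hsub : B1 ⊆ (Finset.Ioc 0 X).filter (fun n => ∃ p, p.Prime ∧ p ^ 5 ∣ n) := by
      intro n hn
      rw [hB1, Finset.mem_filter, hW, Finset.mem_Ioc] at hn
      rw [Finset.mem_filter, Finset.mem_Ioc]
      exact ⟨⟨by omega, hn.1.2⟩, hn.2⟩
    exact le_trans (by exact_mod_cast Finset.card_le_card hsub) (card_not_fiveFree_le X)
  have hB2le : ((B2.card : ℕ) : ℝ) ≤ 3 * ((X + 1 : ℕ) : ℝ) / 64 := by
    have hmap : B2.card = (B2.map ⟨fun n => n + 1, add_left_injective 1⟩).card :=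
      (Finset.card_map _).symm
    have hsub : B2.map ⟨fun n => n + 1, add_left_injective 1⟩ ⊆
        (Finset.Ioc 0 (X + 1)).filter (fun n => ∃ p, p.Prime ∧ p ^ 5 ∣ n) := by
      intro m hm
      rw [Finset.mem_map] at hm
      obtain ⟨n, hn, hm'⟩ := hm
      simp only [Function.Embedding.coeFn_mk] at hm'
      subst hm'
      rw [hB2, Finset.mem_filter, hW, Finset.mem_Ioc] at hn
      rw [Finset.mem_filter, Finset.mem_Ioc]
      obtain ⟨⟨_, hnX⟩, hp⟩ := hn
      exact ⟨⟨Nat.succ_pos n, Nat.succ_le_succ hnX⟩, hp⟩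
    rw [hmap]
    exact le_trans (by exact_mod_cast Finset.card_le_card hsub) (card_not_fiveFree_le (X + 1))
  have hWcard : W.card = X - N := by rw [hW, Nat.card_Ioc]
  have hle : W.card ≤ B1.card + B2.card :=
    le_trans (Finset.card_le_card hcover) (Finset.card_union_le _ _)
  have hleR : ((X - N : ℕ) : ℝ) ≤ (B1.card : ℝ) + (B2.card : ℝ) := by
    rw [← hWcard]; exact_mod_cast hle
  have hXN : ((X - N : ℕ) : ℝ) = (N : ℝ) + 64 := by
    rw [Nat.cast_sub (by omega)]; rw [hX]; push_cast; ring
  rw [hXN] at hleR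
  have hX' : (X : ℝ) = 2 * N + 64 := by rw [hX]; push_cast; ring
  have hX1 : ((X + 1 : ℕ) : ℝ) = 2 * N + 65 := by push_cast; rw [hX']; ring
  rw [hX'] at hB1le
  rw [hX1] at hB2le
  have hN0 : (0 : ℝ) ≤ N := Nat.cast_nonneg N
  linarith

/-- **The 5-free cell contains abc triples with arbitrarily large `c`**: `(1, n, n + 1)` with `n`,
`n + 1` consecutive 5-free integers.  So no cell of `DepthCountedABC` is settled by a finite census,
and `C(0, ε)` is a genuinely asymptotic constant. [folklore] -/
theorem cellZero_unbounded (N : ℕ) :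
    ∃ a b c : ℕ, IsABCTriple a b c ∧
      ((a * b * c).primeFactors.filter (fun p => 5 ≤ (a * b * c).factorization p)).card = 0 ∧
      N < c := by
  obtain ⟨n, hNn, hn, hn1⟩ := exists_consecutive_fiveFree N
  have hn0 : 0 < n := by omega
  refine ⟨1, n, n + 1, ⟨one_pos, hn0, add_comm 1 n, Nat.coprime_one_left n⟩, ?_, by omega⟩
  have hne : 1 * n * (n + 1) ≠ 0 := by positivity
  rw [Finset.card_eq_zero, Finset.filter_eq_empty_iff]
  intro p hp h5
  have hpp := Nat.prime_of_mem_primeFactors hp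
  have hdvd : p ^ 5 ∣ n * (n + 1) := by
    have := (hpp.pow_dvd_iff_le_factorization hne).mpr h5
    simpa [one_mul] using this
  have hcop : Nat.Coprime n (n + 1) := by simp
  -- p divides n or n + 1; the fifth power then divides that factor
  rcases (Nat.Prime.dvd_mul hpp).mp (dvd_trans (dvd_pow_self p (by norm_num)) hdvd) with h | h
  · have hc : Nat.Coprime (p ^ 5) (n + 1) :=
      Nat.Coprime.pow_left 5 (Nat.Coprime.coprime_dvd_left h hcop)
    exact hn p hpp (hc.dvd_of_dvd_mul_right hdvd)
  · have hc : Nat.Coprime (p ^ 5) n :=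
      Nat.Coprime.pow_left 5 (Nat.Coprime.coprime_dvd_left h hcop.symm)
    exact hn1 p hpp (hc.dvd_of_dvd_mul_left hdvd)

/-- **`0 < ε` is load-bearing (as a sign condition)**: the crux quantified over ALL real `ε` is
false — at `ε = −1` it asks for `c < C` on the 5-free cell, whose `c` is unbounded
(`cellZero_unbounded`).  (The boundary case `ε = 0` is the open question treated in
`EpsZeroWieferich.lean`.) [folklore] -/
theorem depthCountedABC_false_without_eps_pos :
    ¬ ∀ K : ℕ, ∀ ε : ℝ, ∃ C : ℝ, 0 < C ∧ ∀ a b c : ℕ, IsABCTriple a b c →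
      ((a * b * c).primeFactors.filter (fun p => 5 ≤ (a * b * c).factorization p)).card ≤ K →
      (c : ℝ) < C * ((rad a b c : ℕ) : ℝ) ^ (1 + ε) := by
  intro h
  obtain ⟨C, hC, hh⟩ := h 0 (-1)
  obtain ⟨a, b, c, ht, h0, hNc⟩ := cellZero_unbounded ⌈C⌉₊
  have := hh a b c ht (le_of_eq h0)
  rw [show (1 : ℝ) + -1 = 0 by ring, Real.rpow_zero, mul_one] at this
  have h1 : (C : ℝ) ≤ ⌈C⌉₊ := Nat.le_ceil C
  have h2 : ((⌈C⌉₊ : ℕ) : ℝ) < c := by exact_mod_cast hNc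
  linarith

end Summit.ABC.ABC.Theorems.DepthCountedABC.Negative
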